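import Literature.AlgebraicGeometry.HodgeTheory.FermatHodgeCharactersPrimePow
import HarnessLib

/-!
# S7: every Hodge multiset of prime-power level `pᵏ` is reachable from the printed supply at its own level

Crux `HodgeFermatVarieties` (stmt-HodgeConjecture-1334), line `cancel-by-any-claim-lattice`, stub S7
`stub_reachPrimePow`. PROVED:

    stub_reachPrimePow : p.Prime → 0 < k → s ≠ 0 → IsHodgeMultiset s → Reach[p ^ k, s]

This is the tree's PROVED Aoki 1987 Thm 1-2, `FermatCharacter.IsHodgeMultiset.exists_std_decomposition`
(file `Literature/AlgebraicGeometry/HodgeTheory/FermatHodgeCharactersPrimePow`):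
`s + (Q + (-Q)) = Σ_{a ∈ I} σ_{p,a} + (Q' + (-Q'))` with Aoki's side condition `2 < d/(⟨a⟩, d)`
(`d = pᵏ/p`) on every `a ∈ I` and `Q`, `Q'` zero-free, re-spelled in the line's vocabulary:

* `N :=` the pairs `{a, -a}`, `a ∈ Q` (first component of `Supply[pᵏ]`; `ΣN = Q + (-Q)` is
  `FermatCharacter.sum_map_pair`);
* `P :=` the standard multisets `σ_{p,a}`, `a ∈ I`, and the pairs `{a, -a}`, `a ∈ Q'`. For `p` odd,
  `σ_{p,a}` is VERBATIM the fourth component of `Supply[pᵏ]` (the `if p = 2` summand is `0`); for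
  `p = 2`, `σ_{2,a} = (a, a + d, -2a, d)` is a Hodge multiset (`FermatCharacter.isHodgeMultiset_std`
  with `FermatCharacter.p_mul_ne_zero_of_two_lt`) with four elements, hence in the second component.

References: [Aoki1987] N. Aoki, Some new algebraic cycles on Fermat varieties, J. Math. Soc. Japan 39
(1987) 385–396, §1 p. 387 and Thm 1-2.
-/

set_option linter.dupNamespace false

noncomputable section

open Finset
open Literature.AlgebraicGeometry.HodgeTheory Literature.AlgebraicGeometry.HodgeTheory.FermatCharacter

namespace Summit.HodgeConjecture.HodgeConjecture.Theorems.CancelByAnyClaimLattice.ReachPrimePow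

/-- `Supply[M]` — the printed supply of level `M` (local notation of the line, verbatim). -/
local notation3 (prettyPrint := false) "Supply[" M "]" =>
  ({s : Multiset (ZMod M) | ∃ a : ZMod M, a ≠ 0 ∧ s = ({a, -a} : Multiset (ZMod M))} ∪
    {s : Multiset (ZMod M) | IsHodgeMultiset s ∧ Multiset.card s = 4} ∪
    {s : Multiset (ZMod M) | IsHodgeMultiset s ∧ IsSemiDecomposable s} ∪
    {s : Multiset (ZMod M) | ∃ (p : ℕ) (a : ZMod M), p.Prime ∧ p ≠ 2 ∧ p ∣ M ∧
        2 < (M / p) / Nat.gcd (ZMod.val a) (M / p) ∧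
        s = Multiset.map (fun j : ℕ => a + (j : ZMod M) * ((M / p : ℕ) : ZMod M)) (Multiset.range p) +
              {-((p : ZMod M) * a)}} : Set (Multiset (ZMod M)))

/-- `Reach[M, s]` (local notation of the line, verbatim). -/
local notation3 (prettyPrint := false) "Reach[" M ", " s "]" =>
  ∃ P N : Multiset (Multiset (ZMod M)),
    (∀ u ∈ P, u ∈ Supply[M]) ∧ (∀ u ∈ N, u ∈ Supply[M]) ∧ s + Multiset.sum N = Multiset.sum P

/-- `LevelRaise[k, m, s]` (local notation of the line, verbatim). -/
local notation3 (prettyPrint := false) "LevelRaise[" k ", " m ", " s "]" =>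
  Multiset.map (fun a : ZMod m => ((k * ZMod.val a : ℕ) : ZMod (k * m))) s

/-- `StableReach[m, s]` (local notation of the line, verbatim). -/
local notation3 (prettyPrint := false) "StableReach[" m ", " s "]" => ∃ k : ℕ, 0 < k ∧ Reach[k * m, LevelRaise[k, m, s]]

variable {p k : ℕ}

/-- A pair `{a, -a}` with `a ≠ 0` lies in the printed supply (first component: linear subspaces,
Aoki Thm 1-1). [cite: Aoki1987, §1 p. 386 (definition of 𝔇ⁿₘ)] -/
theorem pair_mem_supply {M : ℕ} {a : ZMod M} (ha : a ≠ 0) :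
    ({a, -a} : Multiset (ZMod M)) ∈ Supply[M] :=
  Or.inl (Or.inl (Or.inl ⟨a, ha, rfl⟩))

/-- Aoki's standard multiset `σ_{p,a} = {a, a+d, …, a+(p-1)d} + {-pa} (+ {d} if p = 2)` of level `pᵏ`
(`d = pᵏ/p`), under the side condition `2 < d/(⟨a⟩, d)`, lies in the printed supply: for `p` odd it is
VERBATIM the fourth component (witnesses `p`, `a`; `p ∣ pᵏ`); for `p = 2` it is a Hodge multiset
(`isHodgeMultiset_std`, the side condition giving `p a ≠ 0` by `p_mul_ne_zero_of_two_lt`) with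
`2 + 1 + 1 = 4` elements, hence in the second component. [cite: Aoki1987, §1 p. 387] -/
theorem std_mem_supply (hp : p.Prime) (hk : 0 < k) {a : ZMod (p ^ k)}
    (ha : 2 < (p ^ k / p) / Nat.gcd a.val (p ^ k / p)) :
    ((Multiset.range p).map (fun i : ℕ ↦ a + (i : ZMod (p ^ k)) * ((p ^ k / p : ℕ) : ZMod (p ^ k)))
        + {-((p : ZMod (p ^ k)) * a)}
        + (if p = 2 then {((p ^ k / p : ℕ) : ZMod (p ^ k))} else 0)) ∈ Supply[p ^ k] := by
  by_cases hp2 : p = 2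
  · refine Or.inl (Or.inl (Or.inr ⟨isHodgeMultiset_std hp hk (p_mul_ne_zero_of_two_lt hp hk ha), ?_⟩))
    rw [if_pos hp2]
    simp only [Multiset.card_add, Multiset.card_map, Multiset.card_range, Multiset.card_singleton]
    omega
  · refine Or.inr ⟨p, a, hp, hp2, dvd_pow_self p hk.ne', ha, ?_⟩
    rw [if_neg hp2, add_zero]

/-- **S7 `stub_reachPrimePow` — every non-empty Hodge multiset of prime-power level `pᵏ` (`k ≥ 1`) is
ℤ-reachable from the printed supply AT ITS OWN LEVEL.** Aoki 1987 Thm 1-2 in the tree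
(`IsHodgeMultiset.exists_std_decomposition`: `s + (Q + (-Q)) = Σ_{a ∈ I} σ_{p,a} + (Q' + (-Q'))`,
`Q`, `Q'` zero-free, Aoki's side condition on every `a ∈ I`) re-spelled: `N :=` the pairs of `Q`,
`P :=` the standard multisets of `I` (`std_mem_supply`) and the pairs of `Q'`; `ΣN = Q + (-Q)` and
`Σ(pairs of Q') = Q' + (-Q')` by `sum_map_pair`. (The hypothesis `s ≠ 0` is not used.)
[cite: Aoki1987, Thm. 1-2 (p. 387)] -/
theorem stub_reachPrimePow :
    ∀ (p k : ℕ), p.Prime → 0 < k →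
      ∀ s : Multiset (ZMod (p ^ k)), s ≠ 0 → IsHodgeMultiset s → Reach[p ^ k, s] := by
  intro p k hp hk s _ hs
  obtain ⟨I, Q, Q', hI, hQ, hQ', heq⟩ := hs.exists_std_decomposition hp hk
  refine ⟨(I.map fun a ↦
            (Multiset.range p).map (fun i : ℕ ↦ a + (i : ZMod (p ^ k)) * ((p ^ k / p : ℕ) : ZMod (p ^ k)))
              + {-((p : ZMod (p ^ k)) * a)}
              + (if p = 2 then {((p ^ k / p : ℕ) : ZMod (p ^ k))} else 0))
            + Q'.map (fun a ↦ ({a, -a} : Multiset (ZMod (p ^ k)))),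
          Q.map (fun a ↦ ({a, -a} : Multiset (ZMod (p ^ k)))), ?_, ?_, ?_⟩
  · intro u hu
    rcases Multiset.mem_add.mp hu with hu | hu
    · obtain ⟨a, ha, rfl⟩ := Multiset.mem_map.mp hu
      exact std_mem_supply hp hk (hI a ha)
    · obtain ⟨a, ha, rfl⟩ := Multiset.mem_map.mp hu
      exact pair_mem_supply (hQ' a ha)
  · intro u hu
    obtain ⟨a, ha, rfl⟩ := Multiset.mem_map.mp hu
    exact pair_mem_supply (hQ a ha)
  · rw [Multiset.sum_add, sum_map_pair, sum_map_pair]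
    exact heq

end Summit.HodgeConjecture.HodgeConjecture.Theorems.CancelByAnyClaimLattice.ReachPrimePow

end
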